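import Summits.CriticalPhenomena.PercolationContinuityZ3.Theorems.PercNearOneGluingNoHeavyLowerTailSahiCombTriWAndSymSplitCert

/-!
# The symmetric splitting conjecture `(R*sym⁺)` (typed) and the reduction "`(R*sym⁺)` ⟹ every AND-product of good blocks is good"

Support file of the one-cut programme (crux `NoHeavyLowerTail`, stmt-CriticalPhenomena-4575; unit `prim-lf-1` gen 61, memo
`FROM-prim-lf-1-gen61-SYMSPLIT.md` §1, §3b, §4b).  Continuation of `…TriWAndSymSplitCert` (soundness of symmetric splitting certificates).

* **`SymSplitConj`** (`@[conjecture]`, typed) — conjecture `(R*sym⁺)` of the memo: if `P₁ ⊆ 2^{γ₁}` is an antipode-free up-set with `Cor_{P₁} ≥ 0` on up-set pairs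
  (a "good" block) and `Q ⊆ 2^{γ₂}` is ANY non-empty up-set, then for every up-set `A` of the product cube some positive integer multiple `N·δ_A` splits on
  `P₁ × Q` as `Σ_i σ_i(x)·w_i(y) + Σ_j w'_j(x)·σ'_j(y) + ρ(x⊔y) + (inflow − outflow of an upward transport)(x⊔y)` with bounded integer `K`-vectors
  `σ_i` on `P₁`, `σ'_j` on `Q`, `Q`-admissible weights `w_i`, `P₁`-admissible weights `w'_j`, an increasing `ρ` and an upward transport `c` — i.e.
  `δ_A|_{P₁×Q} ∈ K(P₁)⊗Π(Q) + Π(P₁)⊗K(Q) + Mon₊(P₁×Q) + M₋(P₁×Q)` (the admissible weights are exactly the cone `Π` of spanning pairs, memo §1).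
  EVIDENCE (memo §3, §3b; kit, column-generation LP per configuration): ≈ 1.4·10⁶ sampled `K`-configurations on good×good and good×bad pairs of up-sets on
  ≤ 5 variables (maj5², W22111², P5b², Q₄², perfect4/e888/claw4 × 5-blocks, 180 random good pairs, 240 random good×bad pairs, maj5/perfect4/W22111 × 40
  random bad 5-variable up-sets): 0 failures.  The inclusion FAILS for some bad×bad pairs and for non-up-set structures, so both hypotheses are used.
  PROVED CASES (memo §4, §4b): `P₁ = {⊤}`; every principal filter `P₁ = ↑S` (cylinder theorem); single-defect units.
* **`corP_andProd_nonneg_of_symSplit_smul`** — soundness of SCALED certificates (`N·δ_A = …` with `N > 0`), from the pieces of `…TriWAndSymSplitCert`.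
* **`corP_andProd_nonneg_of_symSplitConj`** — THE REDUCTION: `SymSplitConj` implies `Cor_{P₁∧Q}(A,B) ≥ 0` for all up-sets `A, B` whenever `P₁` and `Q` are
  antipode-free up-sets with `Cor ≥ 0` on up-set pairs; i.e. `(R*sym⁺)` settles the AND-problem (II) for all blocks at once.
HONEST LABEL: the reduction and the scaled soundness are proved (std axioms); `SymSplitConj` is an OPEN typed conjecture, never used as a fact. [this work]
-/

namespace Summit.CriticalPhenomena.PercolationContinuityZ3.Theorems

namespace FiveUpSet

open Finset

variable {γ₁ γ₂ : Type} [DecidableEq γ₁] [Fintype γ₁] [DecidableEq γ₂] [Fintype γ₂]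

/-! ### The typed conjecture `(R*sym⁺)` -/

/-- **CONJECTURE `(R*sym⁺)` ("goodness of one factor tensorises linearly against every up-set").**  For an antipode-free up-set `P₁` with
`Cor_{P₁} ≥ 0` on up-set pairs and any non-empty up-set `Q`, every up-set `A` of the product cube admits a scaled symmetric splitting certificate on
`P₁ × Q` (row terms `σ_i ⊗ w_i`, column terms `w'_j ⊗ σ'_j`, an increasing part and an upward transport).  Memo gen 61 §3b; evidence ≈ 1.4·10⁶ LPs,
0 failures; false without "`P₁` good" or without "`Q` an up-set". [this work] -/
@[conjecture] def SymSplitConj : Prop :=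
  ∀ (γ₁ γ₂ : Type) [DecidableEq γ₁] [Fintype γ₁] [DecidableEq γ₂] [Fintype γ₂] (P₁ : Finset (Finset γ₁)) (Q : Finset (Finset γ₂)),
    IsUpperSet (P₁ : Set (Finset γ₁)) → Disjoint P₁ (refl P₁) →
    (∀ U V : Finset (Finset γ₁), IsUpperSet (U : Set (Finset γ₁)) → IsUpperSet (V : Set (Finset γ₁)) → 0 ≤ corP P₁ U V) →
    IsUpperSet (Q : Set (Finset γ₂)) → Q.Nonempty →
    ∀ A : Finset (Finset (γ₁ ⊕ γ₂)), IsUpperSet (A : Set (Finset (γ₁ ⊕ γ₂))) →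
      ∃ (N k k' m m' : ℕ) (σ : Fin k → Finset γ₁ → ℤ) (w : Fin k → Finset γ₂ → ℕ) (σ' : Fin k' → Finset γ₂ → ℤ) (w' : Fin k' → Finset γ₁ → ℕ)
        (ρ : Finset (γ₁ ⊕ γ₂) → ℕ) (c : Finset (γ₁ ⊕ γ₂) → Finset (γ₁ ⊕ γ₂) → ℕ),
        0 < N ∧
        (∀ i, ∀ x ∈ P₁, -(m : ℤ) ≤ σ i x ∧ σ i x ≤ m) ∧ (∀ i, ∀ x ∈ P₁, ∀ x' ∈ P₁, x ⊆ x' → σ i x ≤ σ i x') ∧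
        (∀ i, ∀ x ∈ P₁, ∀ x' ∈ P₁, x ∪ x' = univ → 0 ≤ σ i x + σ i x') ∧
        (∀ i, ∀ S : Finset (Finset γ₂), IsUpperSet (S : Set (Finset γ₂)) → 0 ≤ ∑ y ∈ Q, (w i y : ℤ) * (ind S y - ind S yᶜ)) ∧
        (∀ j, ∀ y ∈ Q, -(m' : ℤ) ≤ σ' j y ∧ σ' j y ≤ m') ∧ (∀ j, ∀ y ∈ Q, ∀ y' ∈ Q, y ⊆ y' → σ' j y ≤ σ' j y') ∧
        (∀ j, ∀ y ∈ Q, ∀ y' ∈ Q, y ∪ y' = univ → 0 ≤ σ' j y + σ' j y') ∧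
        (∀ j, ∀ S : Finset (Finset γ₁), IsUpperSet (S : Set (Finset γ₁)) → 0 ≤ ∑ x ∈ P₁, (w' j x : ℤ) * (ind S x - ind S xᶜ)) ∧
        (∀ t t' : Finset (γ₁ ⊕ γ₂), t ⊆ t' → ρ t ≤ ρ t') ∧ (∀ p q, c p q ≠ 0 → p ⊆ q) ∧
        (∀ x ∈ P₁, ∀ y ∈ Q, (N : ℤ) * sgnDiff A (refl A) (x.disjSum y)
          = ∑ i, σ i x * (w i y : ℤ) + ∑ j, (w' j x : ℤ) * σ' j y + ρ (x.disjSum y)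
            + ((∑ p ∈ andProd P₁ Q, (c p (x.disjSum y) : ℤ)) - ∑ q ∈ andProd P₁ Q, (c (x.disjSum y) q : ℤ)))

/-! ### Soundness of scaled certificates -/

/-- **Soundness of SCALED symmetric certificates**: as `corP_andProd_nonneg_of_symSplit`, but the certificate represents `N·δ_A` for some `N > 0`.
[this work] -/
theorem corP_andProd_nonneg_of_symSplit_smul {ι ι' : Type} [Fintype ι] [DecidableEq ι] [Fintype ι'] [DecidableEq ι']
    {P₁ : Finset (Finset γ₁)} (hP : IsUpperSet (P₁ : Set (Finset γ₁))) (hd : Disjoint P₁ (refl P₁))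
    (hcor : ∀ U V : Finset (Finset γ₁), IsUpperSet (U : Set (Finset γ₁)) → IsUpperSet (V : Set (Finset γ₁)) → 0 ≤ corP P₁ U V)
    {Q : Finset (Finset γ₂)} (hQ : IsUpperSet (Q : Set (Finset γ₂))) (hdQ : Disjoint Q (refl Q))
    (hcorQ : ∀ U V : Finset (Finset γ₂), IsUpperSet (U : Set (Finset γ₂)) → IsUpperSet (V : Set (Finset γ₂)) → 0 ≤ corP Q U V)
    (A : Finset (Finset (γ₁ ⊕ γ₂))) {N : ℕ} (hN : 0 < N)
    (m : ℕ) (σ : ι → Finset γ₁ → ℤ) (hσb : ∀ i, ∀ x ∈ P₁, -(m : ℤ) ≤ σ i x ∧ σ i x ≤ m)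
    (hσm : ∀ i, ∀ x ∈ P₁, ∀ x' ∈ P₁, x ⊆ x' → σ i x ≤ σ i x') (hσp : ∀ i, ∀ x ∈ P₁, ∀ x' ∈ P₁, x ∪ x' = univ → 0 ≤ σ i x + σ i x')
    (w : ι → Finset γ₂ → ℕ)
    (hw : ∀ i, ∀ S : Finset (Finset γ₂), IsUpperSet (S : Set (Finset γ₂)) → 0 ≤ ∑ y ∈ Q, (w i y : ℤ) * (ind S y - ind S yᶜ))
    (m' : ℕ) (σ' : ι' → Finset γ₂ → ℤ) (hσb' : ∀ j, ∀ y ∈ Q, -(m' : ℤ) ≤ σ' j y ∧ σ' j y ≤ m')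
    (hσm' : ∀ j, ∀ y ∈ Q, ∀ y' ∈ Q, y ⊆ y' → σ' j y ≤ σ' j y') (hσp' : ∀ j, ∀ y ∈ Q, ∀ y' ∈ Q, y ∪ y' = univ → 0 ≤ σ' j y + σ' j y')
    (w' : ι' → Finset γ₁ → ℕ)
    (hw' : ∀ j, ∀ S : Finset (Finset γ₁), IsUpperSet (S : Set (Finset γ₁)) → 0 ≤ ∑ x ∈ P₁, (w' j x : ℤ) * (ind S x - ind S xᶜ))
    (ρ : Finset (γ₁ ⊕ γ₂) → ℕ) (hρ : ∀ t t' : Finset (γ₁ ⊕ γ₂), t ⊆ t' → ρ t ≤ ρ t')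
    (c : Finset (γ₁ ⊕ γ₂) → Finset (γ₁ ⊕ γ₂) → ℕ) (hc : ∀ p q, c p q ≠ 0 → p ⊆ q)
    (hsplit : ∀ x ∈ P₁, ∀ y ∈ Q, (N : ℤ) * sgnDiff A (refl A) (x.disjSum y)
      = ∑ i, σ i x * (w i y : ℤ) + ∑ j, (w' j x : ℤ) * σ' j y + ρ (x.disjSum y)
        + ((∑ p ∈ andProd P₁ Q, (c p (x.disjSum y) : ℤ)) - ∑ q ∈ andProd P₁ Q, (c (x.disjSum y) q : ℤ)))
    {B : Finset (Finset (γ₁ ⊕ γ₂))} (hB : IsUpperSet (B : Set (Finset (γ₁ ⊕ γ₂)))) :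
    0 ≤ corP (andProd P₁ Q) A B := by
  -- the four pieces, exactly as in `corP_andProd_nonneg_of_symSplit`
  have hK : 0 ≤ ∑ x ∈ P₁, ∑ y ∈ Q, (∑ i, σ i x * (w i y : ℤ)) * sgnDiff B (refl B) (x.disjSum y) := by
    have e : ∑ x ∈ P₁, ∑ y ∈ Q, (∑ i, σ i x * (w i y : ℤ)) * sgnDiff B (refl B) (x.disjSum y)
        = ∑ i, ∑ x ∈ P₁, σ i x * ∑ y ∈ Q, (w i y : ℤ) * sgnDiff B (refl B) (x.disjSum y) := by
      have s1 : ∑ x ∈ P₁, ∑ y ∈ Q, (∑ i, σ i x * (w i y : ℤ)) * sgnDiff B (refl B) (x.disjSum y)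
          = ∑ x ∈ P₁, ∑ y ∈ Q, ∑ i, σ i x * ((w i y : ℤ) * sgnDiff B (refl B) (x.disjSum y)) :=
        sum_congr rfl fun x _ => sum_congr rfl fun y _ => by rw [Finset.sum_mul]; exact sum_congr rfl fun i _ => by ring
      have s2 : ∑ x ∈ P₁, ∑ y ∈ Q, ∑ i, σ i x * ((w i y : ℤ) * sgnDiff B (refl B) (x.disjSum y))
          = ∑ x ∈ P₁, ∑ i, ∑ y ∈ Q, σ i x * ((w i y : ℤ) * sgnDiff B (refl B) (x.disjSum y)) :=
        sum_congr rfl fun x _ => Finset.sum_comm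
      rw [s1, s2, Finset.sum_comm]
      exact sum_congr rfl fun i _ => sum_congr rfl fun x _ => by rw [Finset.mul_sum]
    rw [e]
    exact sum_nonneg fun i _ => sum_kvec_mul_aRowSum_nonneg hP hd hcor (hσb i) (hσm i) (hσp i) (hw i) hB
  have hK' : 0 ≤ ∑ x ∈ P₁, ∑ y ∈ Q, (∑ j, (w' j x : ℤ) * σ' j y) * sgnDiff B (refl B) (x.disjSum y) := by
    have e : ∑ x ∈ P₁, ∑ y ∈ Q, (∑ j, (w' j x : ℤ) * σ' j y) * sgnDiff B (refl B) (x.disjSum y)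
        = ∑ j, ∑ y ∈ Q, σ' j y * ∑ x ∈ P₁, (w' j x : ℤ) * sgnDiff B (refl B) (x.disjSum y) := by
      have s1 : ∑ x ∈ P₁, ∑ y ∈ Q, (∑ j, (w' j x : ℤ) * σ' j y) * sgnDiff B (refl B) (x.disjSum y)
          = ∑ x ∈ P₁, ∑ y ∈ Q, ∑ j, σ' j y * ((w' j x : ℤ) * sgnDiff B (refl B) (x.disjSum y)) :=
        sum_congr rfl fun x _ => sum_congr rfl fun y _ => by rw [Finset.sum_mul]; exact sum_congr rfl fun j _ => by ring
      have s2 : ∑ x ∈ P₁, ∑ y ∈ Q, ∑ j, σ' j y * ((w' j x : ℤ) * sgnDiff B (refl B) (x.disjSum y))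
          = ∑ j, ∑ x ∈ P₁, ∑ y ∈ Q, σ' j y * ((w' j x : ℤ) * sgnDiff B (refl B) (x.disjSum y)) := by
        rw [show (∑ x ∈ P₁, ∑ y ∈ Q, ∑ j, σ' j y * ((w' j x : ℤ) * sgnDiff B (refl B) (x.disjSum y)))
            = ∑ x ∈ P₁, ∑ j, ∑ y ∈ Q, σ' j y * ((w' j x : ℤ) * sgnDiff B (refl B) (x.disjSum y)) from
          sum_congr rfl fun x _ => Finset.sum_comm, Finset.sum_comm]
      have s3 : ∀ j, ∑ x ∈ P₁, ∑ y ∈ Q, σ' j y * ((w' j x : ℤ) * sgnDiff B (refl B) (x.disjSum y))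
          = ∑ y ∈ Q, σ' j y * ∑ x ∈ P₁, (w' j x : ℤ) * sgnDiff B (refl B) (x.disjSum y) := by
        intro j
        rw [Finset.sum_comm]
        exact sum_congr rfl fun y _ => by rw [Finset.mul_sum]
      rw [s1, s2]
      exact sum_congr rfl fun j _ => s3 j
    rw [e]
    exact sum_nonneg fun j _ => sum_kvec_mul_aColSum_nonneg hQ hdQ hcorQ (hσb' j) (hσm' j) (hσp' j) (hw' j) hB
  have hR : 0 ≤ ∑ t ∈ andProd P₁ Q, (ρ t : ℤ) * sgnDiff B (refl B) t := by
    obtain ⟨R, hR⟩ : ∃ R : ℕ, ∀ t, ρ t ≤ R :=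
      ⟨univ.sup ρ, fun t => le_sup (mem_univ t)⟩
    exact sum_incr_mul_sgnDiff_nonneg (isUpperSet_andProd hP hQ) hB R ρ hR hρ
  have hM : 0 ≤ ∑ t ∈ andProd P₁ Q, sgnDiff B (refl B) t *
      ((∑ p ∈ andProd P₁ Q, (c p t : ℤ)) - ∑ q ∈ andProd P₁ Q, (c t q : ℤ)) := by
    rw [sum_flow_eq]
    exact sum_transport_nonneg hB c hc
  -- `N · Cor = Σ (N δ_A) δ_B`, rewritten through the certificate
  have hNcor : (N : ℤ) * corP (andProd P₁ Q) A B
      = ∑ x ∈ P₁, ∑ y ∈ Q, ((N : ℤ) * sgnDiff A (refl A) (x.disjSum y)) * sgnDiff B (refl B) (x.disjSum y) := by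
    rw [corP_andProd_eq_sum_sum, Finset.mul_sum]
    refine sum_congr rfl fun x _ => ?_
    rw [Finset.mul_sum]
    exact sum_congr rfl fun y _ => by ring
  have e1 : ∑ x ∈ P₁, ∑ y ∈ Q, ((N : ℤ) * sgnDiff A (refl A) (x.disjSum y)) * sgnDiff B (refl B) (x.disjSum y)
      = ∑ x ∈ P₁, ∑ y ∈ Q, (∑ i, σ i x * (w i y : ℤ)) * sgnDiff B (refl B) (x.disjSum y)
        + ∑ x ∈ P₁, ∑ y ∈ Q, (∑ j, (w' j x : ℤ) * σ' j y) * sgnDiff B (refl B) (x.disjSum y)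
        + ∑ x ∈ P₁, ∑ y ∈ Q, ((ρ (x.disjSum y) : ℤ) * sgnDiff B (refl B) (x.disjSum y)
          + sgnDiff B (refl B) (x.disjSum y) *
            ((∑ p ∈ andProd P₁ Q, (c p (x.disjSum y) : ℤ)) - ∑ q ∈ andProd P₁ Q, (c (x.disjSum y) q : ℤ))) := by
    rw [← sum_add_distrib, ← sum_add_distrib]
    refine sum_congr rfl fun x hx => ?_
    rw [← sum_add_distrib, ← sum_add_distrib]
    refine sum_congr rfl fun y hy => ?_
    rw [hsplit x hx y hy]
    ring
  have e2 : ∀ f : Finset (γ₁ ⊕ γ₂) → ℤ, ∑ x ∈ P₁, ∑ y ∈ Q, f (x.disjSum y) = ∑ t ∈ andProd P₁ Q, f t := by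
    intro f
    rw [andProd_eq_biUnion, sum_biUnion (pairwiseDisjoint_rows P₁ Q)]
    exact sum_congr rfl fun x _ => by rw [sum_map]; rfl
  have hN' : (0 : ℤ) ≤ (N : ℤ) * corP (andProd P₁ Q) A B := by
    rw [hNcor, e1, e2 (fun t => (ρ t : ℤ) * sgnDiff B (refl B) t + sgnDiff B (refl B) t *
      ((∑ p ∈ andProd P₁ Q, (c p t : ℤ)) - ∑ q ∈ andProd P₁ Q, (c t q : ℤ))), sum_add_distrib]
    linarith
  have hNpos : (0 : ℤ) < (N : ℤ) := by exact_mod_cast hN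
  exact (mul_nonneg_iff_of_pos_left hNpos).mp hN'

/-! ### The reduction -/

/-- An empty second block gives an empty AND-product. [this work] -/
theorem andProd_empty_right (P₁ : Finset (Finset γ₁)) :
    andProd P₁ (∅ : Finset (Finset γ₂)) = ∅ := by
  ext t; simp [mem_andProd]

/-- `Cor` over the empty family vanishes. [this work] -/
theorem corP_empty (A B : Finset (Finset γ₁)) : corP (∅ : Finset (Finset γ₁)) A B = 0 := by
  unfold corP; simp

/-- **THE REDUCTION `(R*sym⁺)` ⟹ (II).**  Assume `SymSplitConj`.  Then for all antipode-free up-sets `P₁ ⊆ 2^{γ₁}`, `Q ⊆ 2^{γ₂}` with `Cor ≥ 0` on up-set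
pairs, the AND-product satisfies `Cor_{P₁ ∧ Q}(A,B) ≥ 0` for all up-sets `A, B` of the product cube (so `P₁ ∧ Q` is again a good block and the statement
iterates). [this work] -/
theorem corP_andProd_nonneg_of_symSplitConj (hconj : SymSplitConj)
    {P₁ : Finset (Finset γ₁)} (hP : IsUpperSet (P₁ : Set (Finset γ₁))) (hd : Disjoint P₁ (refl P₁))
    (hcor : ∀ U V : Finset (Finset γ₁), IsUpperSet (U : Set (Finset γ₁)) → IsUpperSet (V : Set (Finset γ₁)) → 0 ≤ corP P₁ U V)
    {Q : Finset (Finset γ₂)} (hQ : IsUpperSet (Q : Set (Finset γ₂))) (hdQ : Disjoint Q (refl Q))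
    (hcorQ : ∀ U V : Finset (Finset γ₂), IsUpperSet (U : Set (Finset γ₂)) → IsUpperSet (V : Set (Finset γ₂)) → 0 ≤ corP Q U V)
    {A B : Finset (Finset (γ₁ ⊕ γ₂))} (hA : IsUpperSet (A : Set (Finset (γ₁ ⊕ γ₂)))) (hB : IsUpperSet (B : Set (Finset (γ₁ ⊕ γ₂)))) :
    0 ≤ corP (andProd P₁ Q) A B := by
  rcases Q.eq_empty_or_nonempty with hQe | hQne
  · rw [hQe, andProd_empty_right, corP_empty]
  obtain ⟨N, k, k', m, m', σ, w, σ', w', ρ, c, hN, hσb, hσm, hσp, hw, hσb', hσm', hσp', hw', hρ, hc, hsplit⟩ :=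
    hconj γ₁ γ₂ P₁ Q hP hd hcor hQ hQne A hA
  exact corP_andProd_nonneg_of_symSplit_smul hP hd hcor hQ hdQ hcorQ A hN m σ hσb hσm hσp w hw m' σ' hσb' hσm' hσp' w' hw' ρ hρ c hc
    hsplit hB


/-! ### Appendix (gen 61): the reduction in Kleitman-shell and `TriWIneq` form -/

/-- **`SymSplitConj` ⟹ the AND-product of two good blocks is again an intersecting Kleitman shell** (so the reduction iterates over AND-trees). [this work] -/
theorem klShell_andProd_of_symSplitConj (hconj : SymSplitConj)
    {P₁ : Finset (Finset γ₁)} (hP : IsUpperSet (P₁ : Set (Finset γ₁))) (hd : Disjoint P₁ (refl P₁))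
    (hcor : ∀ U V : Finset (Finset γ₁), IsUpperSet (U : Set (Finset γ₁)) → IsUpperSet (V : Set (Finset γ₁)) → 0 ≤ corP P₁ U V)
    {Q : Finset (Finset γ₂)} (hQ : IsUpperSet (Q : Set (Finset γ₂))) (hdQ : Disjoint Q (refl Q))
    (hcorQ : ∀ U V : Finset (Finset γ₂), IsUpperSet (U : Set (Finset γ₂)) → IsUpperSet (V : Set (Finset γ₂)) → 0 ≤ corP Q U V) :
    KlShell (andProd P₁ Q ∪ refl (andProd P₁ Q)) :=
  klShell_of_corP_nonneg (disjoint_andProd_refl hd Q) fun _ _ hA hB =>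
    corP_andProd_nonneg_of_symSplitConj hconj hP hd hcor hQ hdQ hcorQ hA hB

/-- **`SymSplitConj` ⟹ `TriWIneq` (`0 ≤ triW`) for every AND-product of two good blocks**, on every index cube. [this work] -/
theorem triW_nonneg_andProd_of_symSplitConj {β : Type} [DecidableEq β] [Fintype β] (hconj : SymSplitConj)
    {P₁ : Finset (Finset γ₁)} (hP : IsUpperSet (P₁ : Set (Finset γ₁))) (hd : Disjoint P₁ (refl P₁))
    (hcor : ∀ U V : Finset (Finset γ₁), IsUpperSet (U : Set (Finset γ₁)) → IsUpperSet (V : Set (Finset γ₁)) → 0 ≤ corP P₁ U V)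
    {Q : Finset (Finset γ₂)} (hQ : IsUpperSet (Q : Set (Finset γ₂))) (hdQ : Disjoint Q (refl Q))
    (hcorQ : ∀ U V : Finset (Finset γ₂), IsUpperSet (U : Set (Finset γ₂)) → IsUpperSet (V : Set (Finset γ₂)) → 0 ≤ corP Q U V)
    (F G : Finset β → Finset (Finset (γ₁ ⊕ γ₂)))
    (hF : ∀ x, IsUpperSet (F x : Set (Finset (γ₁ ⊕ γ₂)))) (hG : ∀ x, IsUpperSet (G x : Set (Finset (γ₁ ⊕ γ₂))))
    (hFm : Monotone F) (hGm : Monotone G) :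
    0 ≤ triW (andProd P₁ Q) F G :=
  triW_nonneg_of_corP_nonneg (isUpperSet_andProd hP hQ)
    (fun _ _ hA hB => corP_andProd_nonneg_of_symSplitConj hconj hP hd hcor hQ hdQ hcorQ hA hB) F G hF hG hFm hGm

end FiveUpSet

end Summit.CriticalPhenomena.PercolationContinuityZ3.Theorems
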